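import Literature.Analysis.FunctionSpaces.TorusCubeFluxLocalisation
import Literature.Analysis.FunctionSpaces.TorusFourierSeries
import Literature.Analysis.FunctionSpaces.TorusCalculusProofs
import HarnessLib

/-!
# Jackson's inequality along an axis of `T^d` through the smoothed step multiplier, and its iteration

Analysis/FunctionSpaces proof file (everything proved; no definitions, no named facts).  The axis step multiplier
`Ψᵢ : c ↦ stepSym K Δ (kᵢ) • c` (`TorusAxisStepKernel`; plateau `|kᵢ| ≤ K`, support `|kᵢ| ≤ K + 2Δ`) acts on real
trigonometric polynomials as convolution with the real kernel `stepKernel i K Δ` along the axis `i`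
(`TorusAxisStepCommutator.realTrigPoly_axisStep_eq_integral_sub`).  From the kernel's unit mass, its first moment `≤ 2/Δ`
(`TorusAxisStepKernelMoment`) and its `L¹` norm (bounded when `K ≤ Δ`, §1) we get, for every real trigonometric polynomial `P`:

* §2 the mean-value estimate along an axis, `‖f(x) − f(x − t eᵢ)‖ ≤ |t| ‖∂ᵢ f‖_∞`;
* §3 JACKSON'S INEQUALITY `‖P − Ψᵢ P‖_∞ ≤ (2/Δ) ‖∂ᵢ P‖_∞` (first kernel moment), and its ITERATION
  `‖(1 − Ψᵢ)^r P‖_∞ ≤ (2/Δ)^r ‖∂ᵢ^r P‖_∞` (`Ψᵢ` commutes with `∂ᵢ`: both are coefficient multipliers);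
* §4 sup-norm bounds `‖Ψᵢ P‖_∞ ≤ C_κ ‖P‖_∞`, `‖(1−Ψᵢ)^r P‖_∞ ≤ (1 + C_κ)^r ‖P‖_∞`, `C_κ = ∫|stepKernel| ≤ 4 + (2K+2Δ+1)π/Δ`.

No Lebesgue constant and no power of the band limit `K` enters: this is the currency in which the spectral tail of an ANALYTIC
multiscale carrier must be measured (cell note F-k3l-8; consumer `TorusCubeDescentRungFluxApprox.abs_rungFlux_le_of_approx` and the
band-kill chain of `stub_effectiveFrameEnergyL_bandKill`, K1L_D `stmt-AnomalousDissipation-27980`).  The multi-axis telescoping and the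
passage to smooth (non-polynomial) fields are in the sequel `TorusCubeJackson`.
## Mathlib / tree search
Tree: `TorusAxisStepKernel` (`stepSym`, `stepKernel`, `integral_stepKernel_mul_mFourier_single`), `TorusAxisStepKernelMoment`
(`abs_reprc_mul_abs_stepKernel_le`, `integral_abs_reprc_mul_abs_stepKernel_le`, `integral_majorant_circle_le`, `norm_axisGeom_le`),
`TorusAxisStepCommutator.realTrigPoly_axisStep_eq_integral_sub`, `TorusCalculusProofs.hasDerivAt_comp_add_proj_smul`,
`TorusTrigPoly.partialDeriv_realTrigPoly`.  Mathlib: `Convex.norm_image_sub_le_of_norm_hasDerivWithin_le`, `norm_integral_le_of_norm_le`.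
No Jackson / Favard / Bohr inequality exists in Mathlib or the tree (`rg -i "jackson|favard"` on both: unrelated hits only).
## References
* L. Grafakos, *Classical Fourier Analysis* (3rd ed., 2014), §3.1.3 (de la Vallée-Poussin kernel). [`Grafakos2014`]
* R. A. DeVore, G. G. Lorentz, *Constructive Approximation* (1993), Ch. 7 §2 (Jackson's theorem via kernel moments). [`DeVoreLorentz1993`] -/

noncomputable section

open MeasureTheory Set Filter Complex UnitAddTorus Function Finset
open scoped ENNReal InnerProductSpace ComplexConjugate

namespace Literature.Analysis.FunctionSpaces
namespace Torus

variable {d : Type*} [Fintype d] [DecidableEq d]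

/-! ## §1 The axis step kernel: unit mass, sup bound, `L¹` bound -/

section Kernel

/-- The axis Dirichlet sum has norm at most its number of terms. [cite: Grafakos2014, §3.1.3] -/
theorem norm_axisDirichlet_le (i : d) (N : ℕ) (y : UnitAddTorus d) : ‖axisDirichlet i N y‖ ≤ 2 * N + 1 := by
  unfold axisDirichlet
  rw [norm_mul, norm_mFourier_apply, one_mul]
  refine (norm_sum_le _ _).trans ?_
  simp_rw [norm_mFourier_apply]
  simp

/-- Sup bound of the complex step kernel: `‖k_C(y)‖ ≤ 2(K+Δ)+1`. [cite: Grafakos2014, §3.1.3] -/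
theorem norm_stepKernelC_le (i : d) (K Δ : ℕ) (y : UnitAddTorus d) :
    ‖stepKernelC i K Δ y‖ ≤ 2 * (K + Δ) + 1 := by
  unfold stepKernelC
  rcases Nat.eq_zero_or_pos Δ with hΔ | hΔ
  · subst hΔ; simp; positivity
  have hΔ0 : (0 : ℝ) < Δ := by exact_mod_cast hΔ
  rw [norm_div, norm_mul, norm_mul, Complex.norm_conj, norm_pow, Complex.norm_natCast]
  have h1 := norm_axisDirichlet_le i (K + Δ) y
  have h2 := norm_axisGeom_le i Δ y
  have h3 : ‖axisGeom i Δ y‖ * ‖axisGeom i Δ y‖ ≤ (Δ : ℝ) ^ 2 := by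
    rw [sq]; exact mul_le_mul h2 h2 (norm_nonneg _) (Nat.cast_nonneg _)
  rw [div_le_iff₀ (by positivity)]
  push_cast at h1 ⊢
  calc ‖axisDirichlet i (K + Δ) y‖ * (‖axisGeom i Δ y‖ * ‖axisGeom i Δ y‖)
      ≤ (2 * ((K : ℝ) + Δ) + 1) * (Δ : ℝ) ^ 2 := mul_le_mul h1 h3 (by positivity) (by positivity)
    _ = _ := by ring

/-- Sup bound of the real step kernel: `|k(y)| ≤ 2(K+Δ)+1`. [cite: Grafakos2014, §3.1.3] -/
theorem abs_stepKernel_le (i : d) (K Δ : ℕ) (y : UnitAddTorus d) : |stepKernel i K Δ y| ≤ 2 * (K + Δ) + 1 := by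
  rw [← Real.norm_eq_abs, norm_stepKernel]; exact norm_stepKernelC_le i K Δ y

/-- **Unit mass**: `∫ k = 1` (the multiplier at the zero mode). [cite: Grafakos2014, §3.1.3] -/
theorem integral_stepKernel_eq_one (i : d) (K : ℕ) {Δ : ℕ} (hΔ : 0 < Δ) : ∫ y : UnitAddTorus d, stepKernel i K Δ y = 1 := by
  have h := integral_stepKernel_mul_mFourier_single (d := d) i K Δ 0
  rw [stepSym_eq_one hΔ (by simp), Pi.single_zero] at h
  have h1 : ∫ y : UnitAddTorus d, (stepKernel i K Δ y : ℂ) = ((1 : ℝ) : ℂ) := by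
    rw [← h]; refine integral_congr_ae (ae_of_all _ fun y => ?_); simp [mFourier_zero]
  rw [integral_complex_ofReal] at h1
  exact_mod_cast h1

/-- A pointwise majorant of `|k|` without indicator functions: `|k| ≤ 2Δ·|s|·|k| + 2(2K+2Δ+1)·(1 + 4Δ²s²)⁻¹`, `s` the centred
`i`-th coordinate. [cite: Grafakos2014, §3.1.3] -/
theorem abs_stepKernel_le_majorant (i : d) (K : ℕ) {Δ : ℕ} (hΔ : 0 < Δ) (y : UnitAddTorus d) :
    |stepKernel i K Δ y| ≤ 2 * Δ * (|reprc y i| * |stepKernel i K Δ y|) +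
      2 * (2 * (K + Δ) + 1) * (1 + 4 * (Δ : ℝ) ^ 2 * (reprc y i) ^ 2)⁻¹ := by
  have hΔ0 : (0 : ℝ) < Δ := by exact_mod_cast hΔ
  have hk := abs_stepKernel_le i K Δ y
  have hk0 : 0 ≤ |stepKernel i K Δ y| := abs_nonneg _
  set s := reprc y i with hs
  have hw0 : 0 < (1 + 4 * (Δ : ℝ) ^ 2 * s ^ 2)⁻¹ := by positivity
  by_cases hcase : 1 ≤ 2 * Δ * |s|
  · have h1 : |stepKernel i K Δ y| ≤ 2 * Δ * (|s| * |stepKernel i K Δ y|) := by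
      calc |stepKernel i K Δ y| = 1 * |stepKernel i K Δ y| := (one_mul _).symm
        _ ≤ (2 * Δ * |s|) * |stepKernel i K Δ y| := mul_le_mul_of_nonneg_right hcase hk0
        _ = _ := by ring
    have h2 : 0 ≤ 2 * (2 * ((K : ℝ) + Δ) + 1) * (1 + 4 * (Δ : ℝ) ^ 2 * s ^ 2)⁻¹ := by positivity
    linarith
  · rw [not_le] at hcase
    have hs2 : 4 * (Δ : ℝ) ^ 2 * s ^ 2 < 1 := by
      have : (2 * Δ * |s|) ^ 2 < 1 := by
        have h0 : 0 ≤ 2 * (Δ : ℝ) * |s| := by positivity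
        nlinarith
      calc 4 * (Δ : ℝ) ^ 2 * s ^ 2 = (2 * Δ * |s|) ^ 2 := by rw [mul_pow, mul_pow, sq_abs]; ring
        _ < 1 := this
    have hw : (1 : ℝ) / 2 ≤ (1 + 4 * (Δ : ℝ) ^ 2 * s ^ 2)⁻¹ := by
      rw [one_div]; exact inv_anti₀ (by positivity) (by linarith)
    have h1 : |stepKernel i K Δ y| ≤ 2 * (2 * (K + Δ) + 1) * (1 + 4 * (Δ : ℝ) ^ 2 * s ^ 2)⁻¹ := by
      calc |stepKernel i K Δ y| ≤ 2 * (K + Δ) + 1 := hk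
        _ = 2 * (2 * ((K : ℝ) + Δ) + 1) * (1 / 2) := by ring
        _ ≤ 2 * (2 * ((K : ℝ) + Δ) + 1) * (1 + 4 * (Δ : ℝ) ^ 2 * s ^ 2)⁻¹ :=
            mul_le_mul_of_nonneg_left hw (by positivity)
    have h2 : 0 ≤ 2 * Δ * (|s| * |stepKernel i K Δ y|) := by positivity
    linarith

omit [DecidableEq d] in
/-- The axis majorant `(1 + 4Δ² sᵢ²)⁻¹` integrates to at most `π/(2Δ)` over `T^d`. [cite: Grafakos2014, §3.1.3] -/
theorem integral_inv_one_add_sq_reprc_le (i : d) {Δ : ℕ} (hΔ : 0 < Δ) :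
    ∫ y : UnitAddTorus d, (1 + 4 * (Δ : ℝ) ^ 2 * (reprc y i) ^ 2)⁻¹ ≤ Real.pi / (2 * Δ) := by
  set F : UnitAddCircle → ℝ := fun s => (1 + 4 * (Δ : ℝ) ^ 2 * (centredCoord s) ^ 2)⁻¹ with hF
  have hmeasF : Measurable F := by
    have hc : Measurable centredCoord := by
      unfold centredCoord
      exact ((measurable_subtype_coe.comp (AddCircle.measurableEquivIco (1 : ℝ) 0).measurable).comp
        (measurable_id.add_const _)).sub_const _
    exact (measurable_const.add ((measurable_const.mul (hc.pow_const 2)))).inv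
  have heq : (fun y : UnitAddTorus d => (1 + 4 * (Δ : ℝ) ^ 2 * (reprc y i) ^ 2)⁻¹) = fun y => F (y i) := by
    funext y; rw [hF]; dsimp only; rw [reprc_apply_eq_centredCoord]
  rw [heq]
  have hmp := MeasureTheory.measurePreserving_eval (fun _ : d => (volume : Measure UnitAddCircle)) i
  rw [← MeasureTheory.volume_pi] at hmp
  calc ∫ y : UnitAddTorus d, F (y i) = ∫ s : UnitAddCircle, F s := by
        rw [← hmp.map_eq, integral_map (measurable_pi_apply i).aemeasurable hmeasF.aestronglyMeasurable]
    _ ≤ Real.pi / (2 * Δ) := integral_majorant_circle_le hΔ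

/-- `|k|` is integrable (continuous on a compact group). [cite: Grafakos2014, §3.1.3] -/
theorem integrable_abs_stepKernel (i : d) (K Δ : ℕ) : Integrable (fun y : UnitAddTorus d => |stepKernel i K Δ y|) volume :=
  ((continuous_stepKernel i K Δ).abs).integrable_of_hasCompactSupport (HasCompactSupport.of_compactSpace _)

/-- **`L¹` bound of the axis step kernel**: `∫ |k| ≤ 4 + (2K+2Δ+1)π/Δ` — uniformly bounded when `K ≲ Δ` (a de la Vallée-Poussin
type kernel). [cite: Grafakos2014, §3.1.3] -/
theorem integral_abs_stepKernel_le (i : d) (K : ℕ) {Δ : ℕ} (hΔ : 0 < Δ) :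
    ∫ y : UnitAddTorus d, |stepKernel i K Δ y| ≤ 4 + (2 * (K + Δ) + 1) * Real.pi / Δ := by
  have hΔ0 : (0 : ℝ) < Δ := by exact_mod_cast hΔ
  have h1 := integral_abs_reprc_mul_abs_stepKernel_le (d := d) i K hΔ
  have h2 := integral_inv_one_add_sq_reprc_le (d := d) i hΔ
  have hi1 := integrable_abs_reprc_mul_abs_stepKernel (d := d) i K Δ
  have hi2 : Integrable (fun y : UnitAddTorus d => (1 + 4 * (Δ : ℝ) ^ 2 * (reprc y i) ^ 2)⁻¹) volume := by
    refine Integrable.of_bound ?_ 1 (ae_of_all _ fun y => ?_)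
    · have hm : Measurable fun y : UnitAddTorus d => reprc y i :=
        (EuclideanSpace.proj i : EuclideanSpace ℝ d →L[ℝ] ℝ).continuous.measurable.comp measurable_reprc
      exact (measurable_const.add (measurable_const.mul (hm.pow_const 2))).inv.aestronglyMeasurable
    · rw [Real.norm_eq_abs, abs_of_nonneg (by positivity)]
      exact inv_le_one_of_one_le₀ (by nlinarith [sq_nonneg (reprc y i)])
  calc ∫ y : UnitAddTorus d, |stepKernel i K Δ y|
      ≤ ∫ y : UnitAddTorus d, (2 * Δ * (|reprc y i| * |stepKernel i K Δ y|) +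
          2 * (2 * (K + Δ) + 1) * (1 + 4 * (Δ : ℝ) ^ 2 * (reprc y i) ^ 2)⁻¹) :=
        integral_mono (integrable_abs_stepKernel i K Δ) ((hi1.const_mul _).add (hi2.const_mul _))
          fun y => abs_stepKernel_le_majorant i K hΔ y
    _ = 2 * Δ * (∫ y : UnitAddTorus d, |reprc y i| * |stepKernel i K Δ y|) +
          2 * (2 * (K + Δ) + 1) * ∫ y : UnitAddTorus d, (1 + 4 * (Δ : ℝ) ^ 2 * (reprc y i) ^ 2)⁻¹ := by
        rw [integral_add (hi1.const_mul _) (hi2.const_mul _), integral_const_mul, integral_const_mul]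
    _ ≤ 2 * Δ * (2 / Δ) + 2 * (2 * (K + Δ) + 1) * (Real.pi / (2 * Δ)) :=
        add_le_add (mul_le_mul_of_nonneg_left h1 (by positivity)) (mul_le_mul_of_nonneg_left h2 (by positivity))
    _ = 4 + (2 * (K + Δ) + 1) * Real.pi / Δ := by field_simp; ring

end Kernel

/-! ## §2 The mean-value estimate along an axis -/

section MeanValue

variable {F : Type*} [NormedAddCommGroup F] [NormedSpace ℝ F]

omit [Fintype d] in
/-- The axis shift `x ↦ x − yᵢ eᵢ` is the projection of the centred coordinate times the unit vector.
[cite: Grafakos2014, §3.1.3] -/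
theorem pi_single_eq_proj_smul_single (y : UnitAddTorus d) (i : d) :
    (Pi.single i (y i) : UnitAddTorus d) = proj (reprc y i • EuclideanSpace.single i (1 : ℝ)) := by
  have hy : ((reprc y i : ℝ) : UnitAddCircle) = y i := by
    have := congrArg (fun z : UnitAddTorus d => z i) (proj_reprc y)
    simpa [proj_apply] using this
  ext j
  rw [proj_smul_apply]
  by_cases hj : j = i
  · subst hj; simp [hy]
  · simp [hj]

/-- **Mean value along an axis**: `‖f(z + t eᵢ) − f(z)‖ ≤ |t| · sup ‖∂ᵢ f‖` for a `C¹` function on the torus.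
[cite: Grafakos2014, §3.1.3] -/
theorem norm_sub_le_mul_of_partialDeriv_le {f : UnitAddTorus d → F} (hf : IsContDiff 1 f) (i : d)
    {D : ℝ} (hD : ∀ z, ‖partialDeriv i f z‖ ≤ D) (z : UnitAddTorus d) (t : ℝ) :
    ‖f (z + proj (t • EuclideanSpace.single i (1 : ℝ))) - f z‖ ≤ |t| * D := by
  set φ : ℝ → F := fun s => f (z + proj (s • EuclideanSpace.single i (1 : ℝ))) with hφ
  have hder : ∀ s, HasDerivAt φ (partialDeriv i f (z + proj (s • EuclideanSpace.single i (1 : ℝ)))) s := fun s =>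
    hasDerivAt_comp_add_proj_smul hf z (EuclideanSpace.single i (1 : ℝ)) s
  have hbound : ∀ s ∈ (Set.univ : Set ℝ), ‖partialDeriv i f (z + proj (s • EuclideanSpace.single i (1 : ℝ)))‖ ≤ D :=
    fun s _ => hD _
  have h := Convex.norm_image_sub_le_of_norm_hasDerivWithin_le (𝕜 := ℝ) (f := φ) (s := Set.univ)
    (fun s _ => (hder s).hasDerivWithinAt) hbound convex_univ (Set.mem_univ 0) (Set.mem_univ t)
  have h0 : φ 0 = f z := by simp [hφ, proj_zero]
  rw [h0] at h
  simpa [hφ, Real.norm_eq_abs, mul_comm] using h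

/-- The same along the shift `x ↦ x − yᵢ eᵢ` of the axis kernels: `‖f x − f (x − yᵢeᵢ)‖ ≤ |reprc y i| · sup ‖∂ᵢ f‖`.
[cite: Grafakos2014, §3.1.3] -/
theorem norm_sub_shift_le_mul_of_partialDeriv_le {f : UnitAddTorus d → F} (hf : IsContDiff 1 f) (i : d)
    {D : ℝ} (hD : ∀ z, ‖partialDeriv i f z‖ ≤ D) (x y : UnitAddTorus d) :
    ‖f x - f (x - Pi.single i (y i))‖ ≤ |reprc y i| * D := by
  have h := norm_sub_le_mul_of_partialDeriv_le hf i hD (x - Pi.single i (y i)) (reprc y i)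
  rwa [← pi_single_eq_proj_smul_single, sub_add_cancel] at h

end MeanValue

/-! ## §3 Jackson's inequality along an axis for real trigonometric polynomials, and its iteration -/

section Jackson

omit [Fintype d] in
/-- Continuity of the axis shift `y ↦ yᵢ eᵢ`. [cite: Grafakos2014, §3.1.3] -/
theorem continuous_pi_single_eval (i : d) : Continuous fun y : UnitAddTorus d => (Pi.single i (y i) : UnitAddTorus d) :=
  (continuous_single i).comp (continuous_apply i)

open EuclideanSpace

/-- **Jackson along an axis**: `‖P − Ψᵢ P‖_∞ ≤ (2/Δ) ‖∂ᵢ P‖_∞` for a real trigonometric polynomial `P` — unit mass and first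
moment of the axis step kernel. [cite: DeVoreLorentz1993, Ch. 7 §2] [cite: Grafakos2014, §3.1.3] -/
theorem norm_realTrigPoly_sub_axisStep_le (i : d) (K : ℕ) {Δ : ℕ} (hΔ : 0 < Δ) (S : Finset (d → ℤ))
    (c : (d → ℤ) → EuclideanSpace ℂ d) {D : ℝ}
    (hD : ∀ z, ‖realTrigPoly S (fun k => (2 * Real.pi * Complex.I * (k i)) • c k) z‖ ≤ D) (x : UnitAddTorus d) :
    ‖realTrigPoly S c x - realTrigPoly S (fun k => ((stepSym K Δ (k i) : ℝ) : ℂ) • c k) x‖ ≤ 2 / Δ * D := by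
  have hD0 : 0 ≤ D := (norm_nonneg _).trans (hD x)
  have hP1 : IsContDiff 1 (realTrigPoly S c) := (isSmooth_realTrigPoly S c).isContDiff (by exact_mod_cast le_top)
  have hdP : ∀ z, ‖partialDeriv i (realTrigPoly S c) z‖ ≤ D := fun z => by rw [partialDeriv_realTrigPoly]; exact hD z
  -- hide the axis shift behind an opaque name (definitional unfolding of `Pi.single` on the torus is expensive)
  obtain ⟨ι, hι⟩ : ∃ ι : UnitAddTorus d → UnitAddTorus d, ι = fun y => Pi.single i (y i) := ⟨_, rfl⟩
  have hι' : ∀ y : UnitAddTorus d, (Pi.single i (y i) : UnitAddTorus d) = ι y := fun y => by rw [hι]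
  have hιc : Continuous ι := by rw [hι]; exact continuous_pi_single_eval i
  have hshift : ∀ y : UnitAddTorus d, ‖realTrigPoly S c x - realTrigPoly S c (x - ι y)‖ ≤ |reprc y i| * D := by
    intro y; rw [← hι']; exact norm_sub_shift_le_mul_of_partialDeriv_le hP1 i hdP x y
  rw [realTrigPoly_axisStep_eq_integral_sub]
  simp_rw [hι']
  set P := realTrigPoly S c with hP
  have hPc : Continuous P := continuous_realTrigPoly S c
  have hi1 : Integrable (fun y : UnitAddTorus d => stepKernel i K Δ y • P x) volume :=
    ((continuous_stepKernel i K Δ).smul continuous_const).integrable_of_hasCompactSupport (HasCompactSupport.of_compactSpace _)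
  have hi2 : Integrable (fun y : UnitAddTorus d => stepKernel i K Δ y • P (x - ι y)) volume :=
    ((continuous_stepKernel i K Δ).smul (hPc.comp (continuous_const.sub hιc))).integrable_of_hasCompactSupport
      (HasCompactSupport.of_compactSpace _)
  -- `P x = ∫ k(y) • P x`
  have hmass : (∫ y : UnitAddTorus d, stepKernel i K Δ y • P x) = P x := by
    rw [integral_smul_const, integral_stepKernel_eq_one i K hΔ, one_smul]
  have hdiff : P x - (∫ y : UnitAddTorus d, stepKernel i K Δ y • P (x - ι y)) =
      ∫ y : UnitAddTorus d, stepKernel i K Δ y • (P x - P (x - ι y)) := by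
    calc P x - (∫ y : UnitAddTorus d, stepKernel i K Δ y • P (x - ι y))
        = (∫ y : UnitAddTorus d, stepKernel i K Δ y • P x) - ∫ y : UnitAddTorus d, stepKernel i K Δ y • P (x - ι y) := by
          rw [hmass]
      _ = ∫ y : UnitAddTorus d, (stepKernel i K Δ y • P x - stepKernel i K Δ y • P (x - ι y)) := (integral_sub hi1 hi2).symm
      _ = _ := integral_congr_ae (ae_of_all _ fun y => (smul_sub _ _ _).symm)
  rw [hdiff]
  calc ‖∫ y : UnitAddTorus d, stepKernel i K Δ y • (P x - P (x - ι y))‖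
      ≤ ∫ y : UnitAddTorus d, |reprc y i| * |stepKernel i K Δ y| * D := by
        refine norm_integral_le_of_norm_le ((integrable_abs_reprc_mul_abs_stepKernel i K Δ).mul_const D)
          (ae_of_all _ fun y => ?_)
        rw [norm_smul, Real.norm_eq_abs, mul_assoc, mul_left_comm]
        exact mul_le_mul_of_nonneg_left (hshift y) (abs_nonneg _)
    _ = (∫ y : UnitAddTorus d, |reprc y i| * |stepKernel i K Δ y|) * D := integral_mul_const _ _
    _ ≤ 2 / Δ * D := mul_le_mul_of_nonneg_right (integral_abs_reprc_mul_abs_stepKernel_le i K hΔ) hD0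

/-- **Iterated Jackson along an axis**: `‖(1 − Ψᵢ)^r P‖_∞ ≤ (2/Δ)^r ‖∂ᵢ^r P‖_∞` (`Ψᵢ` and `∂ᵢ` are commuting coefficient
multipliers). [cite: DeVoreLorentz1993, Ch. 7 §2] -/
theorem norm_realTrigPoly_oneSubStep_pow_le (i : d) (K : ℕ) {Δ : ℕ} (hΔ : 0 < Δ) (S : Finset (d → ℤ)) (r : ℕ) :
    ∀ (c : (d → ℤ) → EuclideanSpace ℂ d) {D : ℝ},
      (∀ z, ‖realTrigPoly S (fun k => (2 * Real.pi * Complex.I * (k i)) ^ r • c k) z‖ ≤ D) →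
      ∀ x, ‖realTrigPoly S (fun k => (((1 - stepSym K Δ (k i)) ^ r : ℝ) : ℂ) • c k) x‖ ≤ (2 / Δ) ^ r * D := by
  induction r with
  | zero =>
    intro c D hD x
    have : (fun k : d → ℤ => (((1 - stepSym K Δ (k i)) ^ 0 : ℝ) : ℂ) • c k) = c := by funext k; simp
    rw [this, pow_zero, one_mul]
    simpa using hD x
  | succ r ih =>
    intro c D hD x
    -- `(1−σ)^{r+1} • c = c' − σ • c'` with `c' = (1−σ)^r • c`
    set c' : (d → ℤ) → EuclideanSpace ℂ d := fun k => (((1 - stepSym K Δ (k i)) ^ r : ℝ) : ℂ) • c k with hc'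
    have hsplit : realTrigPoly S (fun k => (((1 - stepSym K Δ (k i)) ^ (r + 1) : ℝ) : ℂ) • c k) =
        realTrigPoly S c' - realTrigPoly S (fun k => ((stepSym K Δ (k i) : ℝ) : ℂ) • c' k) := by
      rw [← realTrigPoly_sub]
      refine realTrigPoly_congr fun k _ => ?_
      simp only [hc', Pi.sub_apply, smul_smul, ← sub_smul]
      congr 1
      push_cast
      ring
    rw [hsplit]
    -- Jackson for `c'`, with derivative bound from the induction hypothesis applied to `(2πi kᵢ) • c`
    have hder : ∀ z, ‖realTrigPoly S (fun k => (2 * Real.pi * Complex.I * (k i)) • c' k) z‖ ≤ (2 / Δ) ^ r * D := by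
      intro z
      have e : (fun k : d → ℤ => (2 * Real.pi * Complex.I * (k i)) • c' k) =
          fun k => (((1 - stepSym K Δ (k i)) ^ r : ℝ) : ℂ) • ((2 * Real.pi * Complex.I * (k i)) • c k) := by
        funext k; simp only [hc', smul_smul, mul_comm]
      rw [e]
      refine ih (fun k => (2 * Real.pi * Complex.I * (k i)) • c k) (fun w => ?_) z
      have e2 : (fun k : d → ℤ => (2 * Real.pi * Complex.I * (k i)) ^ r • (2 * Real.pi * Complex.I * (k i)) • c k) =
          fun k => (2 * Real.pi * Complex.I * (k i)) ^ (r + 1) • c k := by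
        funext k; rw [smul_smul, ← pow_succ]
      rw [e2]; exact hD w
    calc ‖realTrigPoly S c' x - realTrigPoly S (fun k => ((stepSym K Δ (k i) : ℝ) : ℂ) • c' k) x‖
        ≤ 2 / Δ * ((2 / Δ) ^ r * D) := norm_realTrigPoly_sub_axisStep_le i K hΔ S c' hder x
      _ = (2 / Δ) ^ (r + 1) * D := by ring

end Jackson

/-! ## §4 Sup-norm bounds of the axis multipliers -/

section SupBounds

open EuclideanSpace

/-- **`Ψᵢ` is bounded on `L^∞`** by the `L¹` norm of its kernel: `‖Ψᵢ P‖_∞ ≤ (∫|k|) ‖P‖_∞`. [cite: Grafakos2014, §3.1.3] -/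
theorem norm_realTrigPoly_axisStep_le (i : d) (K Δ : ℕ) (S : Finset (d → ℤ)) (c : (d → ℤ) → EuclideanSpace ℂ d)
    {B : ℝ} (hB : ∀ z, ‖realTrigPoly S c z‖ ≤ B) (x : UnitAddTorus d) :
    ‖realTrigPoly S (fun k => ((stepSym K Δ (k i) : ℝ) : ℂ) • c k) x‖ ≤ (∫ y : UnitAddTorus d, |stepKernel i K Δ y|) * B := by
  have hB0 : 0 ≤ B := (norm_nonneg _).trans (hB x)
  rw [realTrigPoly_axisStep_eq_integral_sub]
  calc ‖∫ y : UnitAddTorus d, stepKernel i K Δ y • realTrigPoly S c (x - Pi.single i (y i))‖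
      ≤ ∫ y : UnitAddTorus d, |stepKernel i K Δ y| * B := by
        refine norm_integral_le_of_norm_le ((integrable_abs_stepKernel i K Δ).mul_const B) (ae_of_all _ fun y => ?_)
        rw [norm_smul, Real.norm_eq_abs]
        exact mul_le_mul_of_nonneg_left (hB _) (abs_nonneg _)
    _ = (∫ y : UnitAddTorus d, |stepKernel i K Δ y|) * B := integral_mul_const _ _

/-- **`(1 − Ψᵢ)^r` is bounded on `L^∞`**: `‖(1−Ψᵢ)^r P‖_∞ ≤ (1 + ∫|k|)^r ‖P‖_∞`. [cite: Grafakos2014, §3.1.3] -/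
theorem norm_realTrigPoly_oneSubStep_pow_le_sup (i : d) (K Δ : ℕ) (S : Finset (d → ℤ)) (r : ℕ) :
    ∀ (c : (d → ℤ) → EuclideanSpace ℂ d) {B : ℝ}, (∀ z, ‖realTrigPoly S c z‖ ≤ B) →
      ∀ x, ‖realTrigPoly S (fun k => (((1 - stepSym K Δ (k i)) ^ r : ℝ) : ℂ) • c k) x‖ ≤
        (1 + ∫ y : UnitAddTorus d, |stepKernel i K Δ y|) ^ r * B := by
  induction r with
  | zero =>
    intro c B hB x
    have : (fun k : d → ℤ => (((1 - stepSym K Δ (k i)) ^ 0 : ℝ) : ℂ) • c k) = c := by funext k; simp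
    rw [this, pow_zero, one_mul]; exact hB x
  | succ r ih =>
    intro c B hB x
    set c' : (d → ℤ) → EuclideanSpace ℂ d := fun k => (((1 - stepSym K Δ (k i)) ^ r : ℝ) : ℂ) • c k with hc'
    have hsplit : realTrigPoly S (fun k => (((1 - stepSym K Δ (k i)) ^ (r + 1) : ℝ) : ℂ) • c k) =
        realTrigPoly S c' - realTrigPoly S (fun k => ((stepSym K Δ (k i) : ℝ) : ℂ) • c' k) := by
      rw [← realTrigPoly_sub]
      refine realTrigPoly_congr fun k _ => ?_
      simp only [hc', Pi.sub_apply, smul_smul, ← sub_smul]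
      congr 1
      push_cast
      ring
    rw [hsplit]
    have h1 : ∀ z, ‖realTrigPoly S c' z‖ ≤ (1 + ∫ y : UnitAddTorus d, |stepKernel i K Δ y|) ^ r * B := fun z => ih c hB z
    have h2 := norm_realTrigPoly_axisStep_le i K Δ S c' h1 x
    have hI0 : 0 ≤ ∫ y : UnitAddTorus d, |stepKernel i K Δ y| := integral_nonneg fun y => abs_nonneg _
    calc ‖realTrigPoly S c' x - realTrigPoly S (fun k => ((stepSym K Δ (k i) : ℝ) : ℂ) • c' k) x‖
        ≤ ‖realTrigPoly S c' x‖ + ‖realTrigPoly S (fun k => ((stepSym K Δ (k i) : ℝ) : ℂ) • c' k) x‖ := norm_sub_le _ _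
      _ ≤ (1 + ∫ y : UnitAddTorus d, |stepKernel i K Δ y|) ^ r * B +
            (∫ y : UnitAddTorus d, |stepKernel i K Δ y|) * ((1 + ∫ y : UnitAddTorus d, |stepKernel i K Δ y|) ^ r * B) :=
          add_le_add (h1 x) h2
      _ = (1 + ∫ y : UnitAddTorus d, |stepKernel i K Δ y|) ^ (r + 1) * B := by ring

/-- **The band-limiting polynomial `Ψᵢ^{[r]} = 1 − (1−Ψᵢ)^r` is bounded on `L^∞`**:
`‖Ψᵢ^{[r]} P‖_∞ ≤ (1 + (1 + ∫|k|)^r) ‖P‖_∞`. [cite: Grafakos2014, §3.1.3] -/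
theorem norm_realTrigPoly_stepPoly_le (i : d) (K Δ : ℕ) (S : Finset (d → ℤ)) (r : ℕ) (c : (d → ℤ) → EuclideanSpace ℂ d)
    {B : ℝ} (hB : ∀ z, ‖realTrigPoly S c z‖ ≤ B) (x : UnitAddTorus d) :
    ‖realTrigPoly S (fun k => ((1 - (1 - stepSym K Δ (k i)) ^ r : ℝ) : ℂ) • c k) x‖ ≤
      (1 + (1 + ∫ y : UnitAddTorus d, |stepKernel i K Δ y|) ^ r) * B := by
  have hsplit : realTrigPoly S (fun k => ((1 - (1 - stepSym K Δ (k i)) ^ r : ℝ) : ℂ) • c k) =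
      realTrigPoly S c - realTrigPoly S (fun k => (((1 - stepSym K Δ (k i)) ^ r : ℝ) : ℂ) • c k) := by
    rw [← realTrigPoly_sub]
    refine realTrigPoly_congr fun k _ => ?_
    simp only [Pi.sub_apply]
    push_cast
    rw [sub_smul, one_smul]
  rw [hsplit]
  calc ‖realTrigPoly S c x - realTrigPoly S (fun k => (((1 - stepSym K Δ (k i)) ^ r : ℝ) : ℂ) • c k) x‖
      ≤ ‖realTrigPoly S c x‖ + ‖realTrigPoly S (fun k => (((1 - stepSym K Δ (k i)) ^ r : ℝ) : ℂ) • c k) x‖ := norm_sub_le _ _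
    _ ≤ B + (1 + ∫ y : UnitAddTorus d, |stepKernel i K Δ y|) ^ r * B :=
        add_le_add (hB x) (norm_realTrigPoly_oneSubStep_pow_le_sup i K Δ S r c hB x)
    _ = _ := by ring

end SupBounds

end Torus
end Literature.Analysis.FunctionSpaces

end
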